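/-
Copyright (c) 2026. All rights reserved.
Released under Apache 2.0 license as described in the file LICENSE.
Authors: abc-iut cell, fact-proving seat abc-iut-f-095 (block F, tranche 95).
-/
import Literature.AnabelianGeometry.AbsoluteAnabelian.LogFrobeniusRigidityProofs
import Literature.AnabelianGeometry.AbsoluteAnabelian.DiagramMorphismsAutGroup
import Mathlib.Algebra.Group.Hom.Basic
import Mathlib.Algebra.Group.TypeTags.Basic
import Mathlib.Algebra.Group.Int.Defs
import HarnessLib

/-!
# [AbsTopIII] Corollary 5.5 (v): the `ℤ`-action on `D•⊢` IS a group homomorphism `ℤ → Aut(D•⊢)` (and it is injective)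

S. Mochizuki, *Topics in absolute anabelian geometry III*, J. Math. Sci. Univ. Tokyo 22 (2015)
[MochizukiAbsTopIII2015]; locators = pages of the author's manuscript (`paper:url-5493eb38cbb7`):
Cor 5.5 (v) pp. 131–132 "the natural action of `ℤ` on the infinite linear oriented graph `Γ⃗_{D•_{≤1}}`
extends to an action of `ℤ` on `D•` by nexus-classes of self-equivalences of `D•`", Def 3.5 (v) p. 77
"the automorphism group `Aut(𝒟)` … determined by the isomorphism classes of self-equivalences".

Companion of `LogFrobeniusRigidity.lean` (abc-iut-L4-t3: the shifts `shiftOneMorphism k` and the typed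
clause `Cor55ShiftAction`, whose group-law part (2) had to be phrased "after transport along the equality
of the underlying morphisms of oriented graphs" because `Aut(𝒟)` was then a bare quotient type),
`LogFrobeniusRigidityProofs.lean` (abc-iut-w5-d112: `shiftOneMorphism_isEquivalence`,
`shiftOneMorphism_zero_isomorphic_id`, `shiftOneMorphism_comp_isomorphic`, `shiftSelfEquivalence_isNexusClass`)
and `DiagramMorphismsAutGroup.lean` (abc-iut-f-095: `Aut.group : Group 𝒟.Aut`).  With the group in hand
the print statement takes its literal form, for EVERY setting `L`:

* `shiftSelfEquivalence k` — the shift by `k` as a self-equivalence of `D•⊢`; its class is a nexus class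
  (`isNexusClass_shiftSelfEquivalence`), `shift 0 ≅ id`, `shift l ∘ shift k ≅ shift (k + l)`;
* `shiftAutHom : Multiplicative ℤ →* Aut(D•⊢)`, `k ↦ [shift k]` — **the action of `ℤ` on `D•⊢` by
  (nexus-)classes of self-equivalences is a homomorphism of groups** (`shiftAutHom_ofAdd`);
* `shiftAutHom_injective` — the action is faithful (the shift by `k ≠ 0` moves the vertex `𝒳_0`).

Pure category theory over the typed diagram; refereed pre-IUT material; nothing here bears on the disputed
[IUTchIII] Cor. 3.12 or takes a side; typed ≠ proved elsewhere.
-/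

set_option autoImplicit false

universe u

open CategoryTheory Quiver

namespace Literature.AnabelianGeometry.AbsoluteAnabelian

variable {Vmod : Type u} {isArc : Vmod → Bool}

namespace DVertex

/-- The morphism of oriented graphs underlying the shift by `k` is the identity only for `k = 0`
(it moves `𝒳_0` to `𝒳_k`). [cite: MochizukiAbsTopIII2015, Cor 5.5 (v) p. 132] -/
theorem shiftGraph_eq_id_iff (k : ℤ) :
    shiftGraph (Vmod := Vmod) (isArc := isArc) k = 𝟭q (DVertex Vmod isArc) ↔ k = 0 := by
  refine ⟨fun h => ?_, fun h => h ▸ shiftGraph_zero⟩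
  have h0 : (shiftGraph (Vmod := Vmod) (isArc := isArc) k).obj (.row1 0) = .row1 0 := by
    rw [h]; rfl
  simpa [shiftGraph, DVertex.shift] using h0

end DVertex

namespace LogFrobeniusSetting

variable (L : LogFrobeniusSetting Vmod isArc)

/-- **The shift by `k` as a self-equivalence of `D•⊢`** (Def 3.5 (v)): the morphism of oriented graphs
`⋎ ↦ ⋎ + k`, the 1-morphism `shiftOneMorphism k` over it, and the proof that it is an equivalence of
diagrams of categories. [cite: MochizukiAbsTopIII2015, Cor 5.5 (v) p. 132] -/
def shiftSelfEquivalence (k : ℤ) : L.diagram.SelfEquivalence :=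
  ⟨DVertex.shiftGraph k, L.shiftOneMorphism k, L.shiftOneMorphism_isEquivalence k⟩

/-- The shift self-equivalences are NEXUS self-equivalences of `D•⊢` relative to `□` (abc-iut-w5-d112's
`shiftSelfEquivalence_isNexusClass`, restated for the named self-equivalence).
[cite: MochizukiAbsTopIII2015, Cor 5.5 (v) p. 132] -/
theorem isNexusClass_shiftSelfEquivalence (k : ℤ) :
    (L.shiftSelfEquivalence k).IsNexusClass .core DVertex.rowOne :=
  L.shiftSelfEquivalence_isNexusClass k

/-- **Group law, unit**: the shift by `0` is isomorphic, as a self-equivalence, to the identity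
self-equivalence of `D•⊢`. [cite: MochizukiAbsTopIII2015, Cor 5.5 (v) p. 132] -/
theorem shiftSelfEquivalence_zero_isomorphic_id :
    (L.shiftSelfEquivalence 0).Isomorphic (DiagramOfCategories.SelfEquivalence.id L.diagram) :=
  ⟨DVertex.shiftGraph_zero, L.shiftOneMorphism_zero_isomorphic_id⟩

/-- **Group law, multiplication**: the composite of the shifts by `k` and then `l` is isomorphic, as a
self-equivalence, to the shift by `k + l`. [cite: MochizukiAbsTopIII2015, Cor 5.5 (v) p. 132] -/
theorem shiftSelfEquivalence_comp_isomorphic (k l : ℤ) :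
    ((L.shiftSelfEquivalence k).comp (L.shiftSelfEquivalence l)).Isomorphic
      (L.shiftSelfEquivalence (k + l)) :=
  ⟨DVertex.shiftGraph_comp k l, L.shiftOneMorphism_comp_isomorphic k l⟩

/-- **Cor 5.5 (v): the `ℤ`-action on `D•⊢` by classes of self-equivalences is a GROUP HOMOMORPHISM**
`ℤ → Aut(D•⊢)`, `k ↦ [shift k]` ("the natural action of `ℤ` on `Γ⃗_{D•_{≤1}}` extends to an action of
`ℤ` on `D•` by nexus-classes of self-equivalences"); `ℤ` is written multiplicatively (`Multiplicative ℤ`)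
to map into the group `Aut(D•⊢)` of Def 3.5 (v). [cite: MochizukiAbsTopIII2015, Cor 5.5 (v) p. 132] -/
noncomputable def shiftAutHom : Multiplicative ℤ →* L.diagram.Aut where
  toFun k := DiagramOfCategories.Aut.mk (L.shiftSelfEquivalence (Multiplicative.toAdd k))
  map_one' := DiagramOfCategories.Aut.mk_eq_mk.mpr L.shiftSelfEquivalence_zero_isomorphic_id
  map_mul' k l := by
    change DiagramOfCategories.Aut.mk
        (L.shiftSelfEquivalence (Multiplicative.toAdd k + Multiplicative.toAdd l)) =
      DiagramOfCategories.Aut.mk _ * DiagramOfCategories.Aut.mk _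
    rw [DiagramOfCategories.Aut.mk_mul_mk, DiagramOfCategories.Aut.mk_eq_mk, add_comm]
    exact (L.shiftSelfEquivalence_comp_isomorphic _ _).symm

/-- The value of the action at `k`: the class of the shift by `k`.
[cite: MochizukiAbsTopIII2015, Cor 5.5 (v) p. 132] -/
theorem shiftAutHom_ofAdd (k : ℤ) :
    L.shiftAutHom (Multiplicative.ofAdd k) = DiagramOfCategories.Aut.mk (L.shiftSelfEquivalence k) :=
  rfl

/-- Every value of the action is the class of a NEXUS self-equivalence relative to `□` (Def 3.5 (vi)).
[cite: MochizukiAbsTopIII2015, Cor 5.5 (v) p. 132] -/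
theorem exists_isNexusClass_mk_eq_shiftAutHom (k : Multiplicative ℤ) :
    ∃ Φ : L.diagram.SelfEquivalence,
      Φ.IsNexusClass .core DVertex.rowOne ∧ DiagramOfCategories.Aut.mk Φ = L.shiftAutHom k :=
  ⟨L.shiftSelfEquivalence (Multiplicative.toAdd k), L.isNexusClass_shiftSelfEquivalence _, rfl⟩

/-- **The action is faithful**: `ℤ → Aut(D•⊢)` is injective — isomorphic self-equivalences lie over the
SAME morphism of oriented graphs (Def 3.5 (v)), and the shift by `k ≠ 0` moves the vertex `𝒳_0`.
[cite: MochizukiAbsTopIII2015, Cor 5.5 (v) p. 132] -/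
theorem shiftAutHom_injective : Function.Injective L.shiftAutHom := by
  refine (injective_iff_map_eq_one L.shiftAutHom).mpr fun k hk => ?_
  have hk' : (L.shiftSelfEquivalence (Multiplicative.toAdd k)).Isomorphic
      (DiagramOfCategories.SelfEquivalence.id L.diagram) :=
    DiagramOfCategories.Aut.mk_eq_mk.mp (hk.trans DiagramOfCategories.Aut.one_eq_mk)
  obtain ⟨hgraph, -⟩ := hk'
  have h0 : Multiplicative.toAdd k = 0 := (DVertex.shiftGraph_eq_id_iff _).mp hgraph
  exact Multiplicative.toAdd.injective h0

end LogFrobeniusSetting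

end Literature.AnabelianGeometry.AbsoluteAnabelian
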